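import Summits.Ventures.HodgeRepro2.FixedFieldAut

/-!
# AlgEquivExtension — every automorphism of a subfield of an algebraically closed field extends

`FixedFieldAut.exists_algEquiv_extend` extends a `K`-automorphism of `M` to the algebraically closed field
`L ⊇ M` when `L` is ALGEBRAIC over `M`. This file removes that hypothesis: for ANY tower `K ⊆ M ⊆ L` with
`L` algebraically closed, every `e ∈ Gal(M/K)` extends to some `σ ∈ Gal(L/K)`.

Proof: pick a transcendence basis `v : ι → L` of `L/M` (`exists_isTranscendenceBasis'`); `N := M(v)` is
`M`-isomorphic to the fraction field of `MvPolynomial ι M` (`AlgebraicIndependent.aevalEquivField`), so `e`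
extends to `N` by acting on coefficients (`MvPolynomial.mapAlgEquiv`, `IsFractionRing.algEquivOfAlgEquiv`);
`L` is algebraic over `N` (`IsTranscendenceBasis.isAlgebraic_field`), and `exists_algEquiv_extend` finishes.

Consequences for the cell (T4-B2 B2.7(b), route/T6-B2-HANDOFF-p4.md §4(a)): the restriction map
`Gal(ℂ/ℚ) → Gal(F₁/ℚ)` to a finite Galois subfield `F₁ ⊂ ℂ` is SURJECTIVE (`exists_algEquiv_restrict_eq`),
so every statement of the finite Galois model (ReflexSignature / CosetStabilizer / p1's TraceField, stated for
`Gal(F₁/ℚ)`) transports to `Gal(ℂ/ℚ)` acting through restriction — the «model ↔ Aut(ℂ)» sentence of B2.7(b)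
is a kernel lemma: `fixedField_comap_restrictNormalHom` (Fix_ℂ(res⁻¹ H) = the image of Fix_{F₁}(H)).
-/

namespace Summit.Ventures.HodgeRepro2.AlgEquivExtension

open IntermediateField

section general

variable {K M L : Type*} [Field K] [Field M] [Field L] [Algebra K M] [Algebra K L] [Algebra M L]
  [IsScalarTower K M L] [IsAlgClosed L]

/-- **Extension of automorphisms to an algebraically closed overfield.** For a tower `K ⊆ M ⊆ L` with `L`
algebraically closed, every `K`-automorphism `e` of `M` is the restriction of some `K`-automorphism `σ` of `L`
(no algebraicity of `L/M` is assumed; compare `FixedFieldAut.exists_algEquiv_extend`). -/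
theorem exists_algEquiv_extend_of_isAlgClosed (e : M ≃ₐ[K] M) :
    ∃ σ : L ≃ₐ[K] L, ∀ m : M, σ (algebraMap M L m) = algebraMap M L (e m) := by
  obtain ⟨ι, v, hv⟩ := exists_isTranscendenceBasis' M L
  let N : IntermediateField M L := IntermediateField.adjoin M (Set.range v)
  haveI : Algebra.IsAlgebraic N L := hv.isAlgebraic_field
  haveI : IsScalarTower K N L := IsScalarTower.of_algebraMap_eq fun x => rfl
  let Φ : FractionRing (MvPolynomial ι M) ≃ₐ[M] N := hv.1.aevalEquivField
  let ψ : FractionRing (MvPolynomial ι M) ≃ₐ[K] FractionRing (MvPolynomial ι M) :=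
    IsFractionRing.algEquivOfAlgEquiv (MvPolynomial.mapAlgEquiv ι e)
  let ê : N ≃ₐ[K] N := ((Φ.restrictScalars K).symm.trans ψ).trans (Φ.restrictScalars K)
  obtain ⟨σ, hσ⟩ := FixedFieldAut.exists_algEquiv_extend (K := K) (L := L) (M := N) ê
  refine ⟨σ, fun m => ?_⟩
  have key : ê (algebraMap M N m) = algebraMap M N (e m) := by
    have h1 : algebraMap M N m = Φ (algebraMap M (FractionRing (MvPolynomial ι M)) m) :=
      (Φ.commutes m).symm
    have h2 : ψ (algebraMap M (FractionRing (MvPolynomial ι M)) m) =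
        algebraMap M (FractionRing (MvPolynomial ι M)) (e m) := by
      rw [IsScalarTower.algebraMap_apply M (MvPolynomial ι M) (FractionRing (MvPolynomial ι M)) m,
        IsScalarTower.algebraMap_apply M (MvPolynomial ι M) (FractionRing (MvPolynomial ι M)) (e m)]
      simp only [ψ]
      rw [IsFractionRing.algEquivOfAlgEquiv_algebraMap, MvPolynomial.mapAlgEquiv_apply,
        MvPolynomial.algebraMap_eq, MvPolynomial.map_C]
      rfl
    simp only [ê, AlgEquiv.trans_apply, AlgEquiv.restrictScalars_apply, AlgEquiv.symm_restrictScalars]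
    rw [h1, AlgEquiv.symm_apply_apply, h2, Φ.commutes]
  rw [IsScalarTower.algebraMap_apply M N L m, hσ, key, ← IsScalarTower.algebraMap_apply]

end general

section complex

/-- Every `ℚ`-automorphism of an intermediate field `M ⊂ ℂ` is the restriction of an automorphism of `ℂ`. -/
theorem exists_algEquiv_extend_complex (M : IntermediateField ℚ ℂ) (e : Gal(M/ℚ)) :
    ∃ σ : Gal(ℂ/ℚ), ∀ m : M, σ m = e m := by
  obtain ⟨σ, hσ⟩ := exists_algEquiv_extend_of_isAlgClosed (K := ℚ) (M := M) (L := ℂ) e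
  exact ⟨σ, fun m => by simpa using hσ m⟩

variable (F₁ : IntermediateField ℚ ℂ) [hN : Normal ℚ F₁]

/-- The restriction map `Gal(ℂ/ℚ) → Gal(F₁/ℚ)` to a normal subfield is surjective
(the analogue of Mathlib's `AlgEquiv.restrictNormalHom_surjective`, which needs `ℂ/ℚ` normal — it is not). -/
theorem restrictNormalHom_surjective :
    Function.Surjective (AlgEquiv.restrictNormalHom (F := ℚ) (K₁ := ℂ) F₁) := by
  intro e
  obtain ⟨σ, hσ⟩ := exists_algEquiv_extend_complex F₁ e
  refine ⟨σ, ?_⟩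
  ext m
  exact (@AlgEquiv.restrictNormalHom_apply ℚ _ ℂ _ _ F₁ hN σ m).trans (hσ m)

/-- An automorphism of `ℂ` stabilises `Gal(F₁/ℚ)`-data through its restriction: the stabiliser in `Gal(ℂ/ℚ)`
of an element fixed by `H ≤ Gal(F₁/ℚ)` contains the preimage of `H`. Consequence (the «model ↔ Aut(ℂ)»
bridge): for `H ≤ Gal(F₁/ℚ)`, the fixed field in `ℂ` of `res⁻¹(H)` is the image of the fixed field of `H`
in `F₁` — `⊇` by restriction, `⊆` by `FixedFieldAut.exists_algEquiv_ne` (elements outside `F₁` are moved by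
`Aut(ℂ/F₁) = ker res ⊆ res⁻¹(H)`) and by the surjectivity above (elements of `F₁` fixed by `res⁻¹(H)` are
fixed by all of `H`). -/
theorem fixedField_comap_restrictNormalHom (H : Subgroup Gal(F₁/ℚ)) :
    fixedField (H.comap (AlgEquiv.restrictNormalHom (F := ℚ) (K₁ := ℂ) F₁)) =
      (fixedField H).map (IsScalarTower.toAlgHom ℚ F₁ ℂ) := by
  ext x
  constructor
  · intro hx
    rw [mem_fixedField_iff] at hx
    -- first: x ∈ F₁, because every σ ∈ Aut(ℂ/F₁) lies in the preimage of H
    have hxF : x ∈ F₁ := by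
      by_contra hxF
      have hx' : x ∉ Set.range (algebraMap F₁ ℂ) := by
        rintro ⟨⟨y, hy⟩, rfl⟩
        exact hxF hy
      obtain ⟨σ, hσ⟩ := FixedFieldAut.exists_algEquiv_ne (K := F₁) (L := ℂ) x hx'
      apply hσ
      refine hx (σ.restrictScalars ℚ) ?_
      -- the restriction of σ to F₁ is the identity
      rw [Subgroup.mem_comap]
      have hid : AlgEquiv.restrictNormalHom (F := ℚ) (K₁ := ℂ) F₁ (σ.restrictScalars ℚ) = 1 := by
        ext m
        refine (@AlgEquiv.restrictNormalHom_apply ℚ _ ℂ _ _ F₁ hN (σ.restrictScalars ℚ) m).trans ?_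
        simpa using σ.commutes m
      rw [hid]
      exact H.one_mem
    refine ⟨⟨x, hxF⟩, ?_, rfl⟩
    show (⟨x, hxF⟩ : F₁) ∈ fixedField H
    rw [mem_fixedField_iff]
    intro e he
    obtain ⟨σ, hσ⟩ := restrictNormalHom_surjective F₁ e
    have hσH : σ ∈ H.comap (AlgEquiv.restrictNormalHom (F := ℚ) (K₁ := ℂ) F₁) := by
      rw [Subgroup.mem_comap, hσ]; exact he
    have hx1 := hx σ hσH
    rw [← hσ]
    exact Subtype.ext ((@AlgEquiv.restrictNormalHom_apply ℚ _ ℂ _ _ F₁ hN σ ⟨x, hxF⟩).trans hx1)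
  · rintro ⟨⟨y, hy⟩, hyH, rfl⟩
    change (⟨y, hy⟩ : F₁) ∈ fixedField H at hyH
    rw [mem_fixedField_iff] at hyH ⊢
    intro σ hσ
    rw [Subgroup.mem_comap] at hσ
    have h1 := congrArg Subtype.val (hyH _ hσ)
    have h2 := @AlgEquiv.restrictNormalHom_apply ℚ _ ℂ _ _ F₁ hN σ ⟨y, hy⟩
    have h3 : σ y = y := h2.symm.trans h1
    exact h3

end complex

end Summit.Ventures.HodgeRepro2.AlgEquivExtension
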